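import Summits.QuantumFields.BalabanUV.Beta.GAN24.DerivativeRateTransferJensenMassFreeLogarithm

/-!
# `BalabanUV.Beta.GAN24.DerivativeRateTransferJensenMassFreeKarcherContraction` — binder row G-an2-4 ∕ (CONV-C), route R6 «VALUES, NOT DERIVATIVES», PART 76:
# BAŁABAN–JAFFE's EQUATION (1.29) `Σ_x ln(U(Γ_x)·V⁻¹) = 0` HAS EXACTLY ONE SMALL SOLUTION — in any complete normed `ℝ`-algebra the weighted KARCHER MAP
# `B ↦ Σ_x q_x•log(exp(A_x)·exp(−B))` of data `‖A_x‖ ≤ 1∕100` is within Lipschitz constant `½` of `B ↦ −B` on the ball `‖B‖ ≤ 1∕50` (derivative-free: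
# PART 69's «exp is ½-close to the identity» three times), so the equation `Σ_x q_x•log(exp(A_x)exp(−B)) = 0` has a solution there (Mathlib's contraction
# lemma), it is unique, `‖B‖ ≤ 2‖Σ_x q_x•A_x‖`, and the logarithms at the solution have spread `≤ ‖A_x‖ + (3∕2)‖B‖` (unit b2b-balaban-gan24-p3, gen 46; v1)

NOT IN PRINT; OUR PROOF (for the ROUTE; [folklore] — the Riemannian centre of mass ∕ Karcher mean of nearby points of a compact Lie group exists and is unique
(Karcher 1977, Kendall 1990; for matrix groups e.g. Moakher, SIAM J. Matrix Anal. Appl. 24 (2002) 1–16) BY NAME; here an elementary fixed-point proof with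
explicit radii from PART 69 `norm_exp_sub_exp_sub_le` ∕ `exists_exp_eq_of_norm_sub_one_le` ∕ `exp_injOn_ball` and Mathlib's
`ApproximatesLinearOn.surjOn_closedBall_of_nonlinearRightInverse`).  HONEST FRAMING (cell contract, verbatim): «discharging `BetaPertH` makes Bałaban's UV
stability UNCONDITIONAL — a real constructive-QFT result; it is NOT the continuum limit and NOT the Clay problem.»  HONEST DEPENDENCY (verbatim): «continuum
YM on T⁴ ⇐ BetaPertH ∧ nine spine estimates (0/9 proved); BetaPertH ⇐ (D1) ∧ (D4) ∧ CAP+tail; G-an2-4 gates asym, D1 and NE2/3/4.»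

WHY THIS FILE.  Bałaban–Jaffe [Erice 1985, p. 221] list three block averages of the contour variables `U(Γ_x)`, `x ∈ B(y)`: (1.26) the (modified) polar
factor of the mean, (1.27) Federbush's `V` minimising `d(V) = Σ_x dist²(U(Γ_x), V)` (geodesic distance) — «if the contour variables are close to each other,
then `V` is uniquely defined» —, and (1.28) `exp[L^{−d}Σ_x ln(U(Γ_x)U(yy′)⁻¹)]·U(yy′)`, «motivated by a perturbative expansion of a solution `V` to the
equation (1.29) `Σ_{x∈B(y)} ln(U(Γ_x)V⁻¹) = 0`».  PARTs 66–75 typed (1.26) against (1.28) (third order in the spread) and against any base `τ₀` satisfying the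
first-order condition `Σ_x q_x•log(τ_xτ₀ᵀ) = 0` of (1.27) — but the EXISTENCE and UNIQUENESS of such a base, i.e. of the solution of (1.29), was left ON
REQUEST («Karcher existence», R6-CONVENTION-NOTE §4 (c); the desk PRICING-GAN24 v3.59 R6 (c): «τ ≲ p̂ for (1.27) ∕ (1.28) proper»).  THIS FILE solves
(1.29) in the abstract: with the base written `V = exp(B)·τ₀` and the data `τ_x = exp(A_x)·τ₀`, the logarithms at the base `V` are the small logarithms
`C_x` of `exp(A_x)·exp(−B)` (PART 77 makes this identification for orthogonal matrices), and (1.29) reads `Σ_x q_x•C_x = 0`.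
* §1 (any complete normed `ℝ`-algebra) `norm_exp_mul_exp_neg_sub_one_le` (`‖eᴬe⁻ᴮ − 1‖ ≤ 4‖A‖‖B‖ + 2‖A‖ + 2‖B‖`, no `‖1‖`), the window
  `‖A‖ ≤ 1∕100`, `‖B‖ ≤ 1∕50` ⟹ `‖eᴬe⁻ᴮ − 1‖ ≤ 1∕16` ⟹ the small logarithm `C` exists (PART 69), `‖C‖ ≤ 1∕8`, unique in the ball `1∕4`;
  **`norm_sub_sub_le_of_exp_eq`** — THE LIPSCHITZ LETTER: `exp x = P·exp E`, `exp y = P·exp E′`, `‖x‖, ‖y‖ ≤ ρ ≤ 1`, `‖E‖, ‖E′‖ ≤ ρ′ ≤ 1` ⟹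
  `(1 − 2ρ)‖(x − E) − (y − E′)‖ ≤ (2ρ + 2ρ′ + (1 + 2ρ′)‖P − 1‖)·‖E − E′‖`; **`karcher_lipschitz`**: in the window `‖(C + B) − (C′ + B′)‖ ≤ ½‖B − B′‖`.
* §2 **`karcher_sum_lipschitz`** (the weighted map), **`karcher_unique`** (two solutions in the ball `1∕50` coincide), **`karcher_norm_le`** (`‖B‖ ≤ 2‖Σ_x q_x•A_x‖`),
  **`karcher_log_norm_le`** (`‖C_x‖ ≤ ‖A_x‖ + (3∕2)‖B‖`).
* §3 **`exists_karcher`** — EXISTENCE: `q ≥ 0`, `Σq = 1`, `‖A_x‖ ≤ 1∕100` ⟹ `∃ B, ‖B‖ ≤ 1∕50`, `∃ C_x` (`‖C_x‖ ≤ 1∕4`, `exp(C_x) = exp(A_x)exp(−B)`) with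
  `Σ_x q_x•C_x = 0` (the map `B ↦ −Σ_x q_x•C_x(B)` is `½`-approximately the identity on the ball `1∕50`, its value at `0` is `−Σ_x q_x•A_x` of norm
  `≤ 1∕100 = (1 − ½)·(1∕50)`).

HONEST SCOPE.  Crude radii (`1∕100`, `1∕50`, contraction constant `½`; the true Lipschitz constant is `O(‖A‖)`, ours is `O(‖A‖ + ‖B‖)`); the logarithm is
PART 69's small logarithm (the unique one in the ball `1∕4`), not a global one; no structure group (PART 77: real orthogonal matrices, skewness by
uniqueness); (1.27)'s MINIMISATION itself (that the solution of (1.29) minimises Federbush's `d`) is NOT here — it needs the first variation of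
`‖log‖²` (the Gauss lemma), ON THE PROGRAMME (PART 78); nothing of Bałaban's `Ū ∕ G_k ∕ Δ_k` instantiated; ONE scale; NOT the tower, NOT (CONS),
NOT (CONV-C).

WHAT THIS FILE PROVES (0 sorry, 0 `def`, nothing cited): §1 `norm_exp_mul_exp_neg_sub_one_le`, `norm_exp_mul_exp_neg_sub_one_le_sixteenth`, `exists_log_mul`,
`norm_log_mul_le`, `log_unique`, **`norm_sub_sub_le_of_exp_eq`**, **`karcher_lipschitz`**; §2 `norm_wsum_le'`, `wsum_add_const`, **`karcher_sum_lipschitz`**,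
**`karcher_unique`**, **`karcher_norm_le`**, `karcher_log_norm_le`; §3 **`exists_karcher`**.
SUPPLIER work on route R6 (rank 2, REDUCTION, no seat); no consumer of record; NEVER «G-an2-4 closed»; NOT (CONV-C), NOT D1, NOT `BetaPertH`, NOT continuum,
NOT Clay.  Records: `HOME/b2b-balaban-gan24-p3/WOODBURY-FIBRE.md` v14.6, `HOME/beta/ROUTES-GAN24.md` v60 §3, `HOME/b2b-balaban-gan24-refuter/PRICING-GAN24.md`
v3.59 (R6 row l.507). -/

noncomputable section

open scoped NNReal
open NormedSpace Finset Metric Set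

namespace Summit.QuantumFields.BalabanUV.Beta.GAN24.DerivativeRateTransferJensenMassFreeKarcherContraction

open Summit.QuantumFields.BalabanUV.Beta.GAN24.DerivativeRateTransferJensenMassFreeExpTaylor (norm_exp_sub_one_le wsum_le_of_le)
open Summit.QuantumFields.BalabanUV.Beta.GAN24.DerivativeRateTransferJensenMassFreeLogarithm

/-! ## §1 Two exponential letters in a complete normed real algebra -/

section Banach

variable {𝔸 : Type*} [NormedRing 𝔸] [NormedAlgebra ℝ 𝔸] [CompleteSpace 𝔸]

/-- `exp A · exp(−B) − 1 = (exp A − 1)(exp(−B) − 1) + (exp A − 1) + (exp(−B) − 1)`, hence for `‖A‖, ‖B‖ ≤ 1`: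
`‖exp A · exp(−B) − 1‖ ≤ 4‖A‖‖B‖ + 2‖A‖ + 2‖B‖` (no `‖1‖` enters — the Frobenius norm is not norm-one). [folklore] -/
theorem norm_exp_mul_exp_neg_sub_one_le {A B : 𝔸} (hA : ‖A‖ ≤ 1) (hB : ‖B‖ ≤ 1) :
    ‖exp A * exp (-B) - 1‖ ≤ 4 * ‖A‖ * ‖B‖ + 2 * ‖A‖ + 2 * ‖B‖ := by
  have e : exp A * exp (-B) - 1 = (exp A - 1) * (exp (-B) - 1) + (exp A - 1) + (exp (-B) - 1) := by noncomm_ring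
  have h1 := norm_exp_sub_one_le A hA
  have h2 := norm_exp_sub_one_le (-B) (by rwa [norm_neg])
  rw [norm_neg] at h2
  rw [e]
  calc ‖(exp A - 1) * (exp (-B) - 1) + (exp A - 1) + (exp (-B) - 1)‖
      ≤ ‖(exp A - 1) * (exp (-B) - 1)‖ + ‖exp A - 1‖ + ‖exp (-B) - 1‖ := norm_add₃_le
    _ ≤ ‖exp A - 1‖ * ‖exp (-B) - 1‖ + ‖exp A - 1‖ + ‖exp (-B) - 1‖ := by gcongr; exact norm_mul_le _ _
    _ ≤ (2 * ‖A‖) * (2 * ‖B‖) + 2 * ‖A‖ + 2 * ‖B‖ := by gcongr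
    _ = 4 * ‖A‖ * ‖B‖ + 2 * ‖A‖ + 2 * ‖B‖ := by ring

/-- the window: `‖A‖ ≤ 1∕100`, `‖B‖ ≤ 1∕50` ⟹ `‖exp A · exp(−B) − 1‖ ≤ 1∕16`. -/
theorem norm_exp_mul_exp_neg_sub_one_le_sixteenth {A B : 𝔸} (hA : ‖A‖ ≤ 1 / 100) (hB : ‖B‖ ≤ 1 / 50) :
    ‖exp A * exp (-B) - 1‖ ≤ 1 / 16 := by
  have h := norm_exp_mul_exp_neg_sub_one_le (hA.trans (by norm_num)) (hB.trans (by norm_num))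
  nlinarith [norm_nonneg A, norm_nonneg B]

/-- **THE SMALL LOGARITHM OF `exp A · exp(−B)`** [PART 69]: in the window there is `C` with `‖C‖ ≤ 1∕4`, `exp C = exp A · exp(−B)`; every such `C` has
`‖C‖ ≤ 1∕8`, and it is unique. -/
theorem exists_log_mul {A B : 𝔸} (hA : ‖A‖ ≤ 1 / 100) (hB : ‖B‖ ≤ 1 / 50) :
    ∃ C : 𝔸, ‖C‖ ≤ 1 / 4 ∧ exp C = exp A * exp (-B) :=
  exists_exp_eq_of_norm_sub_one_le ((norm_exp_mul_exp_neg_sub_one_le_sixteenth hA hB).trans (by norm_num))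

/-- a-priori size of the logarithm in the window: `‖C‖ ≤ 2‖exp A · exp(−B) − 1‖ ≤ 1∕8`. -/
theorem norm_log_mul_le {A B C : 𝔸} (hA : ‖A‖ ≤ 1 / 100) (hB : ‖B‖ ≤ 1 / 50) (hC : ‖C‖ ≤ 1 / 4)
    (hCe : exp C = exp A * exp (-B)) : ‖C‖ ≤ 1 / 8 := by
  have h := norm_le_two_mul_norm_exp_sub_one hC
  rw [hCe] at h
  linarith [norm_exp_mul_exp_neg_sub_one_le_sixteenth hA hB]

/-- uniqueness of the logarithm in the ball `1∕4`. [PART 69 `exp_injOn_ball`] -/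
theorem log_unique {C C' : 𝔸} (hC : ‖C‖ ≤ 1 / 4) (hC' : ‖C'‖ ≤ 1 / 4) (h : exp C = exp C') : C = C' :=
  exp_injOn_ball (by rwa [mem_closedBall, dist_zero_right]) (by rwa [mem_closedBall, dist_zero_right]) h

/-- **`norm_sub_sub_le_of_exp_eq` — THE LIPSCHITZ LETTER** [our proof]: if `exp x = P·exp E` and `exp y = P·exp E′` with `‖x‖, ‖y‖ ≤ ρ ≤ 1` and
`‖E‖, ‖E′‖ ≤ ρ′ ≤ 1`, then `(1 − 2ρ)·‖(x − E) − (y − E′)‖ ≤ (2ρ + 2ρ′ + (1 + 2ρ′)‖P − 1‖)·‖E − E′‖`.  Decomposition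
`(x − y) − (E − E′) = [(x − y) − (eˣ − eʸ)] + (P − 1)[(eᴱ − eᴱ′) − (E − E′)] + (P − 1)(E − E′) + [(eᴱ − eᴱ′) − (E − E′)]` and PART 69's
`‖eˣ − eʸ − (x − y)‖ ≤ 2ρ‖x − y‖` twice. -/
theorem norm_sub_sub_le_of_exp_eq {x y E E' P : 𝔸} {ρ ρ' : ℝ} (hx : ‖x‖ ≤ ρ) (hy : ‖y‖ ≤ ρ) (hρ : ρ ≤ 1) (hE : ‖E‖ ≤ ρ')
    (hE' : ‖E'‖ ≤ ρ') (hρ' : ρ' ≤ 1) (hxP : exp x = P * exp E) (hyP : exp y = P * exp E') :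
    (1 - 2 * ρ) * ‖(x - E) - (y - E')‖ ≤ (2 * ρ + 2 * ρ' + (1 + 2 * ρ') * ‖P - 1‖) * ‖E - E'‖ := by
  have h1 := norm_exp_sub_exp_sub_le hx hy hρ
  have h2 := norm_exp_sub_exp_sub_le hE hE' hρ'
  have hρ0 : 0 ≤ ρ := (norm_nonneg x).trans hx
  have hρ'0 : 0 ≤ ρ' := (norm_nonneg E).trans hE
  have e : (x - E) - (y - E') = ((x - y) - (exp x - exp y)) + (P - 1) * ((exp E - exp E') - (E - E')) + (P - 1) * (E - E') +
      ((exp E - exp E') - (E - E')) := by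
    rw [hxP, hyP]; noncomm_ring
  have h3 : ‖(x - E) - (y - E')‖ ≤ 2 * ρ * ‖x - y‖ + ‖P - 1‖ * (2 * ρ' * ‖E - E'‖) + ‖P - 1‖ * ‖E - E'‖ + 2 * ρ' * ‖E - E'‖ := by
    rw [e]
    refine (norm_add_le _ _).trans (add_le_add ((norm_add₃_le).trans (add_le_add (add_le_add ?_ ?_) ?_)) ?_)
    · rw [← norm_neg, neg_sub]; exact h1
    · exact (norm_mul_le _ _).trans (mul_le_mul_of_nonneg_left h2 (norm_nonneg _))
    · exact norm_mul_le _ _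
    · exact h2
  have h4 : ‖x - y‖ ≤ ‖(x - E) - (y - E')‖ + ‖E - E'‖ := by
    have := norm_add_le ((x - E) - (y - E')) (E - E')
    rwa [show (x - E) - (y - E') + (E - E') = x - y by abel] at this
  nlinarith [norm_nonneg (P - 1), norm_nonneg (E - E'), norm_nonneg ((x - E) - (y - E')), mul_le_mul_of_nonneg_left h4 (by positivity : 0 ≤ 2 * ρ)]

/-- **`karcher_lipschitz` — THE KARCHER MAP IS WITHIN `½` OF MINUS THE IDENTITY** [our proof]: in the window `‖A‖ ≤ 1∕100`, `‖B‖, ‖B′‖ ≤ 1∕50`, the small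
logarithms `C = log(exp A·exp(−B))`, `C′ = log(exp A·exp(−B′))` (`‖C‖, ‖C′‖ ≤ 1∕4`) satisfy `‖(C + B) − (C′ + B′)‖ ≤ ½‖B − B′‖`. -/
theorem karcher_lipschitz {A B B' C C' : 𝔸} (hA : ‖A‖ ≤ 1 / 100) (hB : ‖B‖ ≤ 1 / 50) (hB' : ‖B'‖ ≤ 1 / 50) (hC : ‖C‖ ≤ 1 / 4)
    (hC' : ‖C'‖ ≤ 1 / 4) (hCe : exp C = exp A * exp (-B)) (hC'e : exp C' = exp A * exp (-B')) :
    ‖(C + B) - (C' + B')‖ ≤ 1 / 2 * ‖B - B'‖ := by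
  have hC8 := norm_log_mul_le hA hB hC hCe
  have hC'8 := norm_log_mul_le hA hB' hC' hC'e
  have hP : ‖exp A - 1‖ ≤ 1 / 50 := (norm_exp_sub_one_le A (hA.trans (by norm_num))).trans (by linarith)
  have h := norm_sub_sub_le_of_exp_eq (ρ := 1 / 8) (ρ' := 1 / 50) hC8 hC'8 (by norm_num) (by rwa [norm_neg]) (by rwa [norm_neg])
    (by norm_num) hCe hC'e
  rw [show C - -B - (C' - -B') = (C + B) - (C' + B') by abel, show -B - -B' = -(B - B') by abel, norm_neg] at h
  nlinarith [norm_nonneg (B - B'), norm_nonneg ((C + B) - (C' + B')), norm_nonneg (exp A - 1)]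

end Banach

/-! ## §2 The weighted Karcher map: Lipschitz letter, uniqueness and a-priori bounds -/

section Sums

variable {𝔸 : Type*} [NormedRing 𝔸] [NormedAlgebra ℝ 𝔸] [CompleteSpace 𝔸] {ν : Type*} [Fintype ν]

omit [CompleteSpace 𝔸] in
/-- `‖Σ_x q_x•B_x‖ ≤ Σ_x q_x‖B_x‖` for `q ≥ 0`. [folklore] -/
theorem norm_wsum_le' {q : ν → ℝ} (hq : ∀ x, 0 ≤ q x) (B : ν → 𝔸) : ‖∑ x, q x • B x‖ ≤ ∑ x, q x * ‖B x‖ := by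
  refine (norm_sum_le _ _).trans (Finset.sum_le_sum fun x _ => ?_)
  rw [norm_smul, Real.norm_eq_abs, abs_of_nonneg (hq x)]

omit [CompleteSpace 𝔸] in
/-- `Σ_x q_x•(C_x + B) = Σ_x q_x•C_x + B` when `Σq = 1`. [folklore] -/
theorem wsum_add_const {q : ν → ℝ} (hq1 : ∑ x, q x = 1) (C : ν → 𝔸) (B : 𝔸) :
    ∑ x, q x • (C x + B) = ∑ x, q x • C x + B := by
  simp only [smul_add, Finset.sum_add_distrib, ← Finset.sum_smul, hq1, one_smul]

/-- **`karcher_sum_lipschitz`** [our proof]: weights `q ≥ 0`, `Σq = 1`, data `‖A_x‖ ≤ 1∕100`, bases `‖B‖, ‖B′‖ ≤ 1∕50`, small logarithms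
`exp(C_x) = exp(A_x)·exp(−B)`, `exp(C′_x) = exp(A_x)·exp(−B′)` (`‖C_x‖, ‖C′_x‖ ≤ 1∕4`) ⟹ `‖(Σ_x q_x•C_x + B) − (Σ_x q_x•C′_x + B′)‖ ≤ ½‖B − B′‖`:
the map `B ↦ Σ_x q_x•log(exp(A_x)exp(−B))` is within Lipschitz constant `½` of `B ↦ −B`. -/
theorem karcher_sum_lipschitz {q : ν → ℝ} (hq : ∀ x, 0 ≤ q x) (hq1 : ∑ x, q x = 1) {A : ν → 𝔸} (hA : ∀ x, ‖A x‖ ≤ 1 / 100)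
    {B B' : 𝔸} (hB : ‖B‖ ≤ 1 / 50) (hB' : ‖B'‖ ≤ 1 / 50) {C C' : ν → 𝔸} (hC : ∀ x, ‖C x‖ ≤ 1 / 4) (hC' : ∀ x, ‖C' x‖ ≤ 1 / 4)
    (hCe : ∀ x, exp (C x) = exp (A x) * exp (-B)) (hC'e : ∀ x, exp (C' x) = exp (A x) * exp (-B')) :
    ‖(∑ x, q x • C x + B) - (∑ x, q x • C' x + B')‖ ≤ 1 / 2 * ‖B - B'‖ := by
  have e : (∑ x, q x • C x + B) - (∑ x, q x • C' x + B') = ∑ x, q x • ((C x + B) - (C' x + B')) := by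
    rw [← wsum_add_const hq1, ← wsum_add_const hq1, ← Finset.sum_sub_distrib]
    exact Finset.sum_congr rfl fun x _ => (smul_sub _ _ _).symm
  rw [e]
  refine (norm_wsum_le' hq _).trans ((wsum_le_of_le hq hq1 fun x => ?_))
  exact karcher_lipschitz (hA x) hB hB' (hC x) (hC' x) (hCe x) (hC'e x)

/-- **`karcher_unique` — AT MOST ONE SOLUTION IN THE WINDOW** [our proof]: two bases `B, B′` (`‖·‖ ≤ 1∕50`) whose small logarithms have weighted mean zero
coincide. -/
theorem karcher_unique {q : ν → ℝ} (hq : ∀ x, 0 ≤ q x) (hq1 : ∑ x, q x = 1) {A : ν → 𝔸} (hA : ∀ x, ‖A x‖ ≤ 1 / 100)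
    {B B' : 𝔸} (hB : ‖B‖ ≤ 1 / 50) (hB' : ‖B'‖ ≤ 1 / 50) {C C' : ν → 𝔸} (hC : ∀ x, ‖C x‖ ≤ 1 / 4) (hC' : ∀ x, ‖C' x‖ ≤ 1 / 4)
    (hCe : ∀ x, exp (C x) = exp (A x) * exp (-B)) (hC'e : ∀ x, exp (C' x) = exp (A x) * exp (-B'))
    (h0 : ∑ x, q x • C x = 0) (h0' : ∑ x, q x • C' x = 0) : B = B' := by
  have h := karcher_sum_lipschitz hq hq1 hA hB hB' hC hC' hCe hC'e
  rw [h0, h0', zero_add, zero_add] at h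
  have h2 : ‖B - B'‖ = 0 := le_antisymm (by nlinarith [norm_nonneg (B - B')]) (norm_nonneg _)
  exact sub_eq_zero.mp (norm_eq_zero.mp h2)

/-- **`karcher_norm_le` — THE SOLUTION MOVES THE BASE BY AT MOST TWICE THE MEAN OF THE LOGARITHMS** [our proof]: `Σ_x q_x•C_x = 0` ⟹ `‖B‖ ≤ 2‖Σ_x q_x•A_x‖`
(compare with the base `B′ = 0`, whose logarithms are the data `A_x` themselves). -/
theorem karcher_norm_le {q : ν → ℝ} (hq : ∀ x, 0 ≤ q x) (hq1 : ∑ x, q x = 1) {A : ν → 𝔸} (hA : ∀ x, ‖A x‖ ≤ 1 / 100)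
    {B : 𝔸} (hB : ‖B‖ ≤ 1 / 50) {C : ν → 𝔸} (hC : ∀ x, ‖C x‖ ≤ 1 / 4) (hCe : ∀ x, exp (C x) = exp (A x) * exp (-B))
    (h0 : ∑ x, q x • C x = 0) : ‖B‖ ≤ 2 * ‖∑ x, q x • A x‖ := by
  have h := karcher_sum_lipschitz hq hq1 hA hB (B' := 0) (by rw [norm_zero]; norm_num) hC (C' := A) (fun x => (hA x).trans (by norm_num)) hCe
    (fun x => by rw [neg_zero, exp_zero, mul_one]) 
  rw [h0, zero_add, add_zero, sub_zero] at h
  have h2 : ‖B‖ ≤ ‖B - ∑ x, q x • A x‖ + ‖∑ x, q x • A x‖ := by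
    have := norm_add_le (B - ∑ x, q x • A x) (∑ x, q x • A x)
    rwa [sub_add_cancel] at this
  linarith

/-- **`karcher_log_norm_le` — THE SPREAD AT THE SOLUTION** [our proof]: each logarithm at the base `B` satisfies `‖C_x‖ ≤ ‖A_x‖ + (3∕2)‖B‖`. -/
theorem karcher_log_norm_le {A B C : 𝔸} (hA : ‖A‖ ≤ 1 / 100) (hB : ‖B‖ ≤ 1 / 50) (hC : ‖C‖ ≤ 1 / 4) (hCe : exp C = exp A * exp (-B)) :
    ‖C‖ ≤ ‖A‖ + 3 / 2 * ‖B‖ := by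
  have h := karcher_lipschitz hA hB (B' := 0) (by rw [norm_zero]; norm_num) hC (C' := A) (hA.trans (by norm_num)) hCe
    (by rw [neg_zero, exp_zero, mul_one])
  rw [add_zero, sub_zero] at h
  have h2 : ‖C‖ ≤ ‖C + B - A‖ + ‖A‖ + ‖B‖ := by
    have := norm_add₃_le (a := C + B - A) (b := A) (c := -B)
    rwa [norm_neg, show C + B - A + A + -B = C by abel] at this
  linarith

end Sums

/-! ## §3 Existence: the Karcher equation has a solution in the window -/

section Existence

variable {𝔸 : Type*} [NormedRing 𝔸] [NormedAlgebra ℝ 𝔸] [CompleteSpace 𝔸] {ν : Type*} [Fintype ν]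

/-- **`exists_karcher` — THE KARCHER EQUATION `Σ_x q_x•log(exp(A_x)·exp(−B)) = 0` HAS A SOLUTION** [our proof]: in a complete normed `ℝ`-algebra,
weights `q ≥ 0` with `Σq = 1` and data `‖A_x‖ ≤ 1∕100` ⟹ there is `B` with `‖B‖ ≤ 1∕50` and small logarithms `C_x` (`‖C_x‖ ≤ 1∕4`,
`exp(C_x) = exp(A_x)·exp(−B)`) with `Σ_x q_x•C_x = 0`.  Mathlib's contraction lemma `ApproximatesLinearOn.surjOn_closedBall_of_nonlinearRightInverse`
for `B ↦ −Σ_x q_x•log(exp(A_x)exp(−B))`, which §2 shows to be within `½` of the identity on the ball `1∕50`; its value at `0` is `−Σ_x q_x•A_x`, of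
norm `≤ 1∕100 = (1 − ½)·(1∕50)`. -/
theorem exists_karcher {q : ν → ℝ} (hq : ∀ x, 0 ≤ q x) (hq1 : ∑ x, q x = 1) {A : ν → 𝔸} (hA : ∀ x, ‖A x‖ ≤ 1 / 100) :
    ∃ B : 𝔸, ‖B‖ ≤ 1 / 50 ∧ ∃ C : ν → 𝔸, (∀ x, ‖C x‖ ≤ 1 / 4) ∧ (∀ x, exp (C x) = exp (A x) * exp (-B)) ∧ ∑ x, q x • C x = 0 := by
  classical
  have hlog : ∀ B : 𝔸, ‖B‖ ≤ 1 / 50 → ∀ x, ∃ C : 𝔸, ‖C‖ ≤ 1 / 4 ∧ exp C = exp (A x) * exp (-B) :=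
    fun B hB x => exists_log_mul (hA x) hB
  let L : 𝔸 → ν → 𝔸 := fun B x => if h : ‖B‖ ≤ 1 / 50 then Classical.choose (hlog B h x) else 0
  have hL : ∀ B : 𝔸, ∀ hB : ‖B‖ ≤ 1 / 50, ∀ x, ‖L B x‖ ≤ 1 / 4 ∧ exp (L B x) = exp (A x) * exp (-B) := by
    intro B hB x
    simp only [L, dif_pos hB]
    exact Classical.choose_spec (hlog B hB x)
  let f : 𝔸 → 𝔸 := fun B => -∑ x, q x • L B x
  have hf : ApproximatesLinearOn f ((ContinuousLinearEquiv.refl ℝ 𝔸 : 𝔸 ≃L[ℝ] 𝔸) : 𝔸 →L[ℝ] 𝔸) (closedBall (0 : 𝔸) (1 / 50))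
      (2 : ℝ≥0)⁻¹ := by
    intro B hB B' hB'
    rw [mem_closedBall, dist_zero_right] at hB hB'
    have h := karcher_sum_lipschitz hq hq1 hA hB hB' (fun x => (hL B hB x).1) (fun x => (hL B' hB' x).1) (fun x => (hL B hB x).2)
      (fun x => (hL B' hB' x).2)
    have e : f B - f B' - ((ContinuousLinearEquiv.refl ℝ 𝔸 : 𝔸 ≃L[ℝ] 𝔸) : 𝔸 →L[ℝ] 𝔸) (B - B') =
        -((∑ x, q x • L B x + B) - (∑ x, q x • L B' x + B')) := by
      simp only [f, ContinuousLinearEquiv.coe_coe, ContinuousLinearEquiv.refl_apply]; abel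
    rw [e, norm_neg, NNReal.coe_inv, NNReal.coe_ofNat]
    linarith
  have hL0 : ∀ x, L 0 x = A x := fun x =>
    log_unique (hL 0 (by rw [norm_zero]; norm_num) x).1 ((hA x).trans (by norm_num))
      (by rw [(hL 0 (by rw [norm_zero]; norm_num) x).2, neg_zero, exp_zero, mul_one])
  have hf0 : f 0 = -∑ x, q x • A x := by simp only [f, hL0]
  have hf0n : ‖f 0‖ ≤ 1 / 100 := by
    rw [hf0, norm_neg]
    exact (norm_wsum_le' hq A).trans (wsum_le_of_le hq hq1 hA)
  rcases subsingleton_or_nontrivial 𝔸 with h | h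
  · refine ⟨0, by rw [norm_zero]; norm_num, fun _ => 0, fun x => by rw [norm_zero]; norm_num, fun x => Subsingleton.elim _ _, ?_⟩
    simp only [smul_zero, Finset.sum_const_zero]
  · have hs := hf.surjOn_closedBall_of_nonlinearRightInverse (ContinuousLinearEquiv.refl ℝ 𝔸).toNonlinearRightInverse (ε := 1 / 50)
      (b := 0) (by norm_num) Subset.rfl
    have hn : ((ContinuousLinearEquiv.refl ℝ 𝔸).toNonlinearRightInverse).nnnorm = 1 := by
      show ‖((ContinuousLinearEquiv.refl ℝ 𝔸).symm : 𝔸 →L[ℝ] 𝔸)‖₊ = 1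
      rw [ContinuousLinearEquiv.refl_symm, ContinuousLinearEquiv.coe_refl, ContinuousLinearMap.nnnorm_id]
    rw [hn] at hs
    have hr : (((1 : ℝ≥0) : ℝ)⁻¹ - ((2 : ℝ≥0)⁻¹ : ℝ≥0)) * (1 / 50 : ℝ) = 1 / 100 := by
      rw [NNReal.coe_one, NNReal.coe_inv, NNReal.coe_ofNat]; norm_num
    have hmem : (0 : 𝔸) ∈ closedBall (f 0) ((((1 : ℝ≥0) : ℝ)⁻¹ - ((2 : ℝ≥0)⁻¹ : ℝ≥0)) * (1 / 50)) := by
      rw [mem_closedBall, hr, dist_eq_norm, zero_sub, norm_neg]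
      exact hf0n
    obtain ⟨B, hBmem, hfB⟩ := hs hmem
    rw [mem_closedBall, dist_zero_right] at hBmem
    refine ⟨B, hBmem, L B, fun x => (hL B hBmem x).1, fun x => (hL B hBmem x).2, ?_⟩
    have h2 : -∑ x, q x • L B x = 0 := hfB
    rwa [neg_eq_zero] at h2

end Existence

end Summit.QuantumFields.BalabanUV.Beta.GAN24.DerivativeRateTransferJensenMassFreeKarcherContraction

end
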